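import Summits.CriticalPhenomena.PercolationContinuityZ3.Theorems.PercNearOneGluingNoHeavyLowerTailSunflowerLeafLeafFree
import Summits.CriticalPhenomena.PercolationContinuityZ3.Theorems.PercNearOneGluingNoHeavyLowerTailSunflowerLeafLeafDiagonal
import HarnessLib

/-!
# `NoHeavyLowerTail` (crux stmt-CriticalPhenomena-4575), abstract sunflower cubic: `FreeFour` — the DIAGONAL CLASSES and the
# EXCHANGE REDUCTION (analytic side of the leaf-leaf lemma, part 1)

Support file (seat `prim-ineq-prove-1` gen 67; `--supports stmt-CriticalPhenomena-4575`).  No `sorry`, no named facts, no new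
definitions.  Memo: run/shared/lean/prim/prim-ineq-prove-1/FINDING-FREEFOUR-prove1-g67.md §4.

`FreeFour σ s τ t α` (`…SunflowerLeafLeafFree`) is the six-number block inequality equivalent to the leaf-leaf lemma: petals
`(e,g,f,h; y, x)` with `y ≥ (1−s)e+sg` (row link) and `x ≥ (1−σ)e+σf` (column link).  This file proves, ANALYTICALLY (no measure
theory), the two "diagonal" classes and the exchange step:
* **`freeFour_of_xLink`** — the conclusion of `FreeFour` for every family whose column resource sits at its link (`x_j = (1−σ)e_j+σf_j`,
  the `z₂`-diagonal petals of `…SunflowerLeafLeafDiagonal`), from FOUR of the eleven budgets (`y`, the `u`-open row, the block, the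
  `w`-closed column).  Proof = the analytic core of `leafLeaf_diagonal`: in the `z₂`-picture `f = t·u + (1−t)·l` with
  `u = τ + (1−τ)(s+(1−s)x)` (one coin: `prod_wavg_le`) and `l = τ(σ+(1−σ)y) + (1−τ)·block` (a capped-pendant family:
  `cappedPendant_holds`, i.e. T-BERN at `V = 1`); the link gives the alignment `g·u ≤ a·l`, and aligned factors merge
  (`LeafLeafZ.interp_prod_le`).
* **`freeFour_of_yLink`** — the mirror statement (`y_j` at its link; budgets `x`, the `w`-open column, the block, the `u`-closed row).
* **`prod_yExchange_le_max`** — the exchange step for the free row resource: moving `y_i ↦ θy_i`, `y_j ↦ y_j/θ` keeps every budget and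
  the product of the two affected factors is `p + qθ + r/θ` (`q, r ≥ 0`), hence maximal at an end of any interval `[θ_lo, θ_hi] ∋ 1`
  (`LinkedCurrency.pqr_le_max`).  Consequently a maximiser of `FreeFour`'s left side may be taken with at most ONE `y` strictly between
  its link and `1`, and likewise for `x` (memo §4.2); with `freeFour_of_xLink/yLink` and the `x = 1` / `y = 1` endgames
  (`…SunflowerLeafLeafZTwo`) this leaves the families {base petals + one `x`-slack petal + one `y`-slack petal} (memo §5).
-/

noncomputable section

namespace Summit.CriticalPhenomena.PercolationContinuityZ3.Theorems.SunflowerPartition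

namespace SafeCalc

namespace LeafLeafZ

open Finset LinkedCurrency

/-- **`FreeFour` on the `z₂`-diagonal class** (column resource at its link), from the four budgets `y`, `u`-open row, block,
`w`-closed column.  Coins in `[0,1]`, floors `0 < α₀₀ ≤ α₀₁, α₁₀ ≤ α₁₁ ≤ 1`. [this work] -/
theorem freeFour_of_xLink {σ s τ t α00 α01 α10 α11 : ℝ} (hσ0 : 0 ≤ σ) (hσ1 : σ ≤ 1) (hs0 : 0 ≤ s) (hs1 : s ≤ 1)
    (hτ0 : 0 ≤ τ) (hτ1 : τ ≤ 1) (ht0 : 0 ≤ t) (ht1 : t ≤ 1) (hα : 0 < α00) (h01 : α00 ≤ α01) (h10 : α00 ≤ α10)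
    (h0111 : α01 ≤ α11) (h1011 : α10 ≤ α11) (h11 : α11 ≤ 1)
    {n : ℕ} (e g f h y : Fin n → ℝ)
    (he : ∀ j, α00 ≤ e j) (hg : ∀ j, α01 ≤ g j) (hf : ∀ j, α10 ≤ f j) (hh : ∀ j, α11 ≤ h j) (hh1 : ∀ j, h j ≤ 1)
    (leg : ∀ j, e j ≤ g j) (lef : ∀ j, e j ≤ f j) (lgh : ∀ j, g j ≤ h j) (lfh : ∀ j, f j ≤ h j)
    (ly : ∀ j, (1 - s) * e j + s * g j ≤ y j) (hy1 : ∀ j, y j ≤ 1)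
    (By : ∏ j, y j ≤ ((1 - s) * α00 + s * α01) ^ (n - 1))
    (Br1 : ∏ j, ((1 - s) * f j + s * h j) ≤ ((1 - s) * α10 + s * α11) ^ (n - 1))
    (BA : ∏ j, ((1 - σ) * ((1 - s) * e j + s * g j) + σ * ((1 - s) * f j + s * h j)) ≤
      ((1 - σ) * ((1 - s) * α00 + s * α01) + σ * ((1 - s) * α10 + s * α11)) ^ (n - 1))
    (Bc0 : ∏ j, ((1 - σ) * e j + σ * f j) ≤ ((1 - σ) * α00 + σ * α10) ^ (n - 1)) :
    ∏ j, (τ * t + τ * (1 - t) * σ + (1 - τ) * t * s + τ * (1 - t) * (1 - σ) * y j +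
        (1 - τ) * t * (1 - s) * ((1 - σ) * e j + σ * f j) +
        (1 - τ) * (1 - t) * ((1 - σ) * ((1 - s) * e j + s * g j) + σ * ((1 - s) * f j + s * h j))) ≤
      (τ * t + τ * (1 - t) * σ + (1 - τ) * t * s + τ * (1 - t) * (1 - σ) * ((1 - s) * α00 + s * α01) +
        (1 - τ) * t * (1 - s) * ((1 - σ) * α00 + σ * α10) +
        (1 - τ) * (1 - t) * ((1 - σ) * ((1 - s) * α00 + s * α01) + σ * ((1 - s) * α10 + s * α11))) ^ (n - 1) := by
  classical
  rcases Nat.eq_zero_or_pos n with rfl | hn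
  · simp
  have hσ' : 0 ≤ 1 - σ := sub_nonneg.2 hσ1
  have hs' : 0 ≤ 1 - s := sub_nonneg.2 hs1
  have hτ' : 0 ≤ 1 - τ := sub_nonneg.2 hτ1
  have ht' : 0 ≤ 1 - t := sub_nonneg.2 ht1
  -- floors of the derived quantities
  set b : ℝ := (1 - s) * α00 + s * α01 with hb
  set β : ℝ := (1 - s) * α10 + s * α11 with hβ
  set c : ℝ := (1 - σ) * α00 + σ * α10 with hc
  set gv : ℝ := τ * (σ + (1 - σ) * b) + (1 - τ) * ((1 - σ) * b + σ * β) with hgv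
  set av : ℝ := τ + (1 - τ) * (s + (1 - s) * c) with hav
  have hα01_1 : α01 ≤ 1 := h0111.trans h11
  have hα10_1 : α10 ≤ 1 := h1011.trans h11
  have hα00_1 : α00 ≤ 1 := h01.trans hα01_1
  have hb0 : 0 < b := by
    have k := mul_nonneg hs0 (sub_nonneg.2 h01)
    have e1 : b = α00 + s * (α01 - α00) := by rw [hb]; ring
    rw [e1]; linarith
  have hbβ : b ≤ β := by
    have k1 := mul_nonneg hs' (sub_nonneg.2 h10)
    have k2 := mul_nonneg hs0 (sub_nonneg.2 h0111)
    have e1 : β - b = (1 - s) * (α10 - α00) + s * (α11 - α01) := by rw [hb, hβ]; ring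
    linarith
  have hβ1 : β ≤ 1 := by
    have k1 := mul_le_mul_of_nonneg_left hα10_1 hs'
    have k2 := mul_le_mul_of_nonneg_left h11 hs0
    rw [hβ]; linarith
  have hc0 : 0 < c := by
    have k := mul_nonneg hσ0 (sub_nonneg.2 h10)
    have e1 : c = α00 + σ * (α10 - α00) := by rw [hc]; ring
    rw [e1]; linarith
  have hαb : b ≤ (1 - σ) * b + σ * β := by
    have k := mul_nonneg hσ0 (sub_nonneg.2 hbβ)
    linarith
  have h3 : σ + (1 - σ) * b ≤ 1 := by
    have k := mul_le_mul_of_nonneg_left (hbβ.trans hβ1) hσ'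
    linarith
  have hgv0 : 0 < gv := by
    have k0 : σ * β ≤ σ * 1 := mul_le_mul_of_nonneg_left hβ1 hσ0
    have k1 : 0 ≤ τ * (σ + (1 - σ) * b - ((1 - σ) * b + σ * β)) := mul_nonneg hτ0 (by linarith)
    have e1 : gv = ((1 - σ) * b + σ * β) + τ * (σ + (1 - σ) * b - ((1 - σ) * b + σ * β)) := by rw [hgv]; ring
    rw [e1]; linarith
  have hga : gv ≤ av := by
    have h2 : (1 - σ) * α01 + σ * α11 ≤ 1 := by
      have k1 := mul_le_mul_of_nonneg_left hα01_1 hσ'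
      have k2 := mul_le_mul_of_nonneg_left h11 hσ0
      linarith
    have k1 : 0 ≤ τ * (1 - (σ + (1 - σ) * b)) := mul_nonneg hτ0 (sub_nonneg.2 h3)
    have k2 : 0 ≤ (1 - τ) * s * (1 - ((1 - σ) * α01 + σ * α11)) := mul_nonneg (mul_nonneg hτ' hs0) (sub_nonneg.2 h2)
    have e1 : av - gv = τ * (1 - (σ + (1 - σ) * b)) + (1 - τ) * s * (1 - ((1 - σ) * α01 + σ * α11)) := by
      rw [hav, hgv, hb, hβ, hc]; ring
    linarith
  have hav0 : 0 < av := hgv0.trans_le hga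
  -- elementary facts on the cells
  have hr0b : ∀ j, b ≤ (1 - s) * e j + s * g j := fun j => by
    have k1 := mul_le_mul_of_nonneg_left (he j) hs'
    have k2 := mul_le_mul_of_nonneg_left (hg j) hs0
    rw [hb]; linarith
  have hr1β : ∀ j, β ≤ (1 - s) * f j + s * h j := fun j => by
    have k1 := mul_le_mul_of_nonneg_left (hf j) hs'
    have k2 := mul_le_mul_of_nonneg_left (hh j) hs0
    rw [hβ]; linarith
  have hr01 : ∀ j, (1 - s) * e j + s * g j ≤ (1 - s) * f j + s * h j := fun j => by
    have k1 := mul_le_mul_of_nonneg_left (lef j) hs'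
    have k2 := mul_le_mul_of_nonneg_left (lgh j) hs0
    linarith
  have hc0c : ∀ j, c ≤ (1 - σ) * e j + σ * f j := fun j => by
    have k1 := mul_le_mul_of_nonneg_left (he j) hσ'
    have k2 := mul_le_mul_of_nonneg_left (hf j) hσ0
    rw [hc]; linarith
  have hblk0 : ∀ j, 0 ≤ (1 - σ) * ((1 - s) * e j + s * g j) + σ * ((1 - s) * f j + s * h j) := fun j =>
    add_nonneg (mul_nonneg hσ' (hb0.le.trans (hr0b j))) (mul_nonneg hσ0 ((hb0.le.trans hbβ).trans (hr1β j)))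
  have hy0 : ∀ j, 0 ≤ y j := fun j => (hb0.le.trans (hr0b j)).trans (ly j)
  -- the petal data in the `z₂`-picture
  set l : Fin n → ℝ := fun j => τ * (σ + (1 - σ) * y j) +
    (1 - τ) * ((1 - σ) * ((1 - s) * e j + s * g j) + σ * ((1 - s) * f j + s * h j)) with hl
  set u : Fin n → ℝ := fun j => τ + (1 - τ) * (s + (1 - s) * ((1 - σ) * e j + σ * f j)) with hu
  have hne : (univ : Finset (Fin n)).Nonempty := ⟨⟨0, hn⟩, mem_univ _⟩
  have hcard : (univ : Finset (Fin n)).card = n := by simp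
  -- budget of the `l`'s: the capped pendant lemma at `V = 1`
  have hr1_1 : ∀ j, (1 - s) * f j + s * h j ≤ 1 := fun j => by
    have k1 := mul_le_mul_of_nonneg_left ((lfh j).trans (hh1 j)) hs'
    have k2 := mul_le_mul_of_nonneg_left (hh1 j) hs0
    linarith
  have hBl : ∏ j, l j ≤ gv ^ (n - 1) := by
    have key := cappedPendant_holds (s := σ) (t := τ) (b := b) (β := β) (V := 1) hb0 hbβ hβ1 hσ0 hσ1 hτ0 hτ1 n y
      (fun j => (1 - s) * f j + s * h j) (fun j => (1 - s) * e j + s * g j)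
      (fun j => (hr0b j).trans (ly j)) hy1 hr1β hr1_1 hr0b ly hr01
      (by rw [hb]; exact By) (by rw [hβ, mul_one]; exact Br1) (by rw [hb, hβ, mul_one]; exact BA)
    have e1 : ∀ j, σ * τ + σ * (1 - τ) * ((1 - s) * f j + s * h j) + (1 - σ) * τ * y j +
        (1 - σ) * (1 - τ) * ((1 - s) * e j + s * g j) = l j := fun j => by simp only [hl]; ring
    have e2 : (σ * τ + σ * (1 - τ) * β + (1 - σ) * b) ^ (n - 1) * (τ + (1 - τ) * 1) = gv ^ (n - 1) := by
      rw [hgv]; ring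
    rw [← e2, ← prod_congr rfl fun j _ => e1 j]; exact key
  -- budget of the `u`'s: one coin
  have hBu : ∏ j, u j ≤ av ^ (n - 1) := by
    have hρ0 : 0 ≤ (1 - τ) * (1 - s) := mul_nonneg hτ' hs'
    have hρ1 : (1 - τ) * (1 - s) ≤ 1 := by
      have k : (1 - τ) * (1 - s) ≤ (1 - τ) * 1 := mul_le_mul_of_nonneg_left (by linarith) hτ'
      linarith
    have hB' : ∏ j ∈ (univ : Finset (Fin n)), ((1 - σ) * e j + σ * f j) ≤ c ^ ((univ : Finset (Fin n)).card - 1) := by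
      rw [hcard, hc]; exact Bc0
    have key := prod_wavg_le (s := (1 - τ) * (1 - s)) (e := (1 : ℝ)) (f := c) hρ0 hρ1 zero_le_one hc0 univ hne
      (fun j => (1 - σ) * e j + σ * f j) (fun j _ => hc0c j) hB'
    rw [hcard] at key
    have e1 : ∀ j, (1 - τ) * (1 - s) * ((1 - σ) * e j + σ * f j) + (1 - (1 - τ) * (1 - s)) * (1 : ℝ) = u j := fun j => by
      simp only [hu]; ring
    have e2 : ((1 - τ) * (1 - s) * c + (1 - (1 - τ) * (1 - s)) * (1 : ℝ)) ^ (n - 1) *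
        ((1 - τ) * (1 - s) + (1 - (1 - τ) * (1 - s)) * (1 : ℝ)) = av ^ (n - 1) := by rw [hav]; ring
    rw [← e2, ← prod_congr rfl fun j _ => e1 j]; exact key
  -- alignment `g·u ≤ a·l` for every petal
  have hua : ∀ j, av ≤ u j := fun j => by
    have k := mul_nonneg (mul_nonneg hτ' hs') (sub_nonneg.2 (hc0c j))
    have e1 : u j - av = (1 - τ) * (1 - s) * ((1 - σ) * e j + σ * f j - c) := by simp only [hu]; rw [hav]; ring
    linarith
  have hal : ∀ j ∈ (univ : Finset (Fin n)), gv * u j ≤ av * l j := by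
    intro j _
    have h1 : u j + gv ≤ l j + av := by
      have k1 : 0 ≤ τ * (1 - σ) * (y j - b) := mul_nonneg (mul_nonneg hτ0 hσ') (sub_nonneg.2 ((hr0b j).trans (ly j)))
      have k2a : 0 ≤ (1 - σ) * (g j - α01) + σ * (h j - α11) :=
        add_nonneg (mul_nonneg hσ' (sub_nonneg.2 (hg j))) (mul_nonneg hσ0 (sub_nonneg.2 (hh j)))
      have k2 : 0 ≤ (1 - τ) * s * ((1 - σ) * (g j - α01) + σ * (h j - α11)) := mul_nonneg (mul_nonneg hτ' hs0) k2a
      have e1 : l j + av - (u j + gv) = τ * (1 - σ) * (y j - b) + (1 - τ) * s * ((1 - σ) * (g j - α01) + σ * (h j - α11)) := by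
        simp only [hl, hu]; rw [hgv, hav, hb, hβ, hc]; ring
      linarith
    have k3 := mul_le_mul_of_nonneg_left h1 hav0.le
    have k4 : 0 ≤ (av - gv) * (u j - av) := mul_nonneg (sub_nonneg.2 hga) (sub_nonneg.2 (hua j))
    have e3 : av * l j - gv * u j = (av * (l j + av) - av * (u j + gv)) + (av - gv) * (u j - av) := by ring
    linarith
  -- merge
  have hl0 : ∀ j ∈ (univ : Finset (Fin n)), 0 ≤ l j := fun j _ =>
    add_nonneg (mul_nonneg hτ0 (add_nonneg hσ0 (mul_nonneg hσ' (hy0 j)))) (mul_nonneg hτ' (hblk0 j))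
  have hu0 : ∀ j ∈ (univ : Finset (Fin n)), 0 ≤ u j := fun j _ => hav0.le.trans (hua j)
  have key := interp_prod_le ht0 ht1 hav0 hgv0 univ hne u l hu0 hl0 hal (by rw [hcard]; exact hBu) (by rw [hcard]; exact hBl)
  rw [hcard] at key
  have e1 : ∀ j, t * u j + (1 - t) * l j = τ * t + τ * (1 - t) * σ + (1 - τ) * t * s + τ * (1 - t) * (1 - σ) * y j +
      (1 - τ) * t * (1 - s) * ((1 - σ) * e j + σ * f j) +
      (1 - τ) * (1 - t) * ((1 - σ) * ((1 - s) * e j + s * g j) + σ * ((1 - s) * f j + s * h j)) := fun j => by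
    simp only [hu, hl]; ring
  have e2 : t * av + (1 - t) * gv = τ * t + τ * (1 - t) * σ + (1 - τ) * t * s +
      τ * (1 - t) * (1 - σ) * ((1 - s) * α00 + s * α01) + (1 - τ) * t * (1 - s) * ((1 - σ) * α00 + σ * α10) +
      (1 - τ) * (1 - t) * ((1 - σ) * ((1 - s) * α00 + s * α01) + σ * ((1 - s) * α10 + s * α11)) := by
    rw [hav, hgv, hb, hβ, hc]; ring
  rw [← e2, ← prod_congr rfl fun j _ => e1 j]; exact key

/-- **`FreeFour` on the `z₁`-diagonal class** (row resource at its link), from the four budgets `x`, `w`-open column, block,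
`u`-closed row — the mirror image of `freeFour_of_xLink` under `(u,σ,z₁,τ,y) ↔ (w,s,z₂,t,x)`. [this work] -/
theorem freeFour_of_yLink {σ s τ t α00 α01 α10 α11 : ℝ} (hσ0 : 0 ≤ σ) (hσ1 : σ ≤ 1) (hs0 : 0 ≤ s) (hs1 : s ≤ 1)
    (hτ0 : 0 ≤ τ) (hτ1 : τ ≤ 1) (ht0 : 0 ≤ t) (ht1 : t ≤ 1) (hα : 0 < α00) (h01 : α00 ≤ α01) (h10 : α00 ≤ α10)
    (h0111 : α01 ≤ α11) (h1011 : α10 ≤ α11) (h11 : α11 ≤ 1)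
    {n : ℕ} (e g f h x : Fin n → ℝ)
    (he : ∀ j, α00 ≤ e j) (hg : ∀ j, α01 ≤ g j) (hf : ∀ j, α10 ≤ f j) (hh : ∀ j, α11 ≤ h j) (hh1 : ∀ j, h j ≤ 1)
    (leg : ∀ j, e j ≤ g j) (lef : ∀ j, e j ≤ f j) (lgh : ∀ j, g j ≤ h j) (lfh : ∀ j, f j ≤ h j)
    (lx : ∀ j, (1 - σ) * e j + σ * f j ≤ x j) (hx1 : ∀ j, x j ≤ 1)
    (Bx : ∏ j, x j ≤ ((1 - σ) * α00 + σ * α10) ^ (n - 1))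
    (Bc1 : ∏ j, ((1 - σ) * g j + σ * h j) ≤ ((1 - σ) * α01 + σ * α11) ^ (n - 1))
    (BA : ∏ j, ((1 - σ) * ((1 - s) * e j + s * g j) + σ * ((1 - s) * f j + s * h j)) ≤
      ((1 - σ) * ((1 - s) * α00 + s * α01) + σ * ((1 - s) * α10 + s * α11)) ^ (n - 1))
    (Br0 : ∏ j, ((1 - s) * e j + s * g j) ≤ ((1 - s) * α00 + s * α01) ^ (n - 1)) :
    ∏ j, (τ * t + τ * (1 - t) * σ + (1 - τ) * t * s + τ * (1 - t) * (1 - σ) * ((1 - s) * e j + s * g j) +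
        (1 - τ) * t * (1 - s) * x j +
        (1 - τ) * (1 - t) * ((1 - σ) * ((1 - s) * e j + s * g j) + σ * ((1 - s) * f j + s * h j))) ≤
      (τ * t + τ * (1 - t) * σ + (1 - τ) * t * s + τ * (1 - t) * (1 - σ) * ((1 - s) * α00 + s * α01) +
        (1 - τ) * t * (1 - s) * ((1 - σ) * α00 + σ * α10) +
        (1 - τ) * (1 - t) * ((1 - σ) * ((1 - s) * α00 + s * α01) + σ * ((1 - s) * α10 + s * α11))) ^ (n - 1) := by
  have BA' : ∏ j, ((1 - s) * ((1 - σ) * e j + σ * f j) + s * ((1 - σ) * g j + σ * h j)) ≤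
      ((1 - s) * ((1 - σ) * α00 + σ * α10) + s * ((1 - σ) * α01 + σ * α11)) ^ (n - 1) := by
    have e1 : ∀ j, (1 - s) * ((1 - σ) * e j + σ * f j) + s * ((1 - σ) * g j + σ * h j) =
        (1 - σ) * ((1 - s) * e j + s * g j) + σ * ((1 - s) * f j + s * h j) := fun j => by ring
    have e2 : (1 - s) * ((1 - σ) * α00 + σ * α10) + s * ((1 - σ) * α01 + σ * α11) =
        (1 - σ) * ((1 - s) * α00 + s * α01) + σ * ((1 - s) * α10 + s * α11) := by ring
    rw [e2, prod_congr rfl fun j _ => e1 j]; exact BA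
  have key := freeFour_of_xLink (σ := s) (s := σ) (τ := t) (t := τ) hs0 hs1 hσ0 hσ1 ht0 ht1 hτ0 hτ1 hα h10 h01 h1011 h0111
    h11 e f g h x he hf hg hh hh1 lef leg lfh lgh lx hx1 Bx Bc1 BA' Br0
  have e1 : ∀ j, t * τ + t * (1 - τ) * s + (1 - t) * τ * σ + t * (1 - τ) * (1 - s) * x j +
      (1 - t) * τ * (1 - σ) * ((1 - s) * e j + s * g j) +
      (1 - t) * (1 - τ) * ((1 - s) * ((1 - σ) * e j + σ * f j) + s * ((1 - σ) * g j + σ * h j)) =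
      τ * t + τ * (1 - t) * σ + (1 - τ) * t * s + τ * (1 - t) * (1 - σ) * ((1 - s) * e j + s * g j) +
        (1 - τ) * t * (1 - s) * x j +
        (1 - τ) * (1 - t) * ((1 - σ) * ((1 - s) * e j + s * g j) + σ * ((1 - s) * f j + s * h j)) := fun j => by ring
  have e2 : t * τ + t * (1 - τ) * s + (1 - t) * τ * σ + t * (1 - τ) * (1 - s) * ((1 - σ) * α00 + σ * α10) +
      (1 - t) * τ * (1 - σ) * ((1 - s) * α00 + s * α01) +
      (1 - t) * (1 - τ) * ((1 - s) * ((1 - σ) * α00 + σ * α10) + s * ((1 - σ) * α01 + σ * α11)) =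
      τ * t + τ * (1 - t) * σ + (1 - τ) * t * s + τ * (1 - t) * (1 - σ) * ((1 - s) * α00 + s * α01) +
        (1 - τ) * t * (1 - s) * ((1 - σ) * α00 + σ * α10) +
        (1 - τ) * (1 - t) * ((1 - σ) * ((1 - s) * α00 + s * α01) + σ * ((1 - s) * α10 + s * α11)) := by ring
  rw [← e2, ← prod_congr rfl fun j _ => e1 j]; exact key

/-! ## The exchange step for a free resource -/

/-- **Exchange step.**  Two factors `K_i + P·y_i`, `K_j + P·y_j` (`K_i, P, y_j ≥ 0`) under the budget-preserving move
`y_i ↦ θy_i`, `y_j ↦ y_j/θ`: their product at `θ = 1` is at most its value at one end of any interval `[θ_lo, θ_hi] ∋ 1`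
(`θ_lo > 0`), because it is `p + qθ + r/θ` with `q, r ≥ 0`.  Used with `θ_lo = max(link_i/y_i, y_j)` and `θ_hi = min(1/y_i, y_j/link_j)`,
where one of the two resources becomes tight or capped (memo §4.2). [this work] -/
theorem prod_exchange_le_max {Ki Kj P yi yj tlo thi : ℝ} (hKi : 0 ≤ Ki) (hP : 0 ≤ P)
    (hyj : 0 ≤ yj) (hlo : 0 < tlo) (hlo1 : tlo ≤ 1) (hhi : 1 ≤ thi) :
    (Ki + P * yi) * (Kj + P * yj) ≤
      max ((Ki + P * (yi * tlo)) * (Kj + P * (yj / tlo))) ((Ki + P * (yi * thi)) * (Kj + P * (yj / thi))) := by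
  have hthi : 0 < thi := zero_lt_one.trans_le hhi
  have key := pqr_le_max (p := Ki * Kj + P * P * (yi * yj)) (q := P * Kj * yi) (r := P * Ki * yj)
    (mul_nonneg (mul_nonneg hP hKi) hyj) hlo hlo1 hhi
  have e0 : (Ki + P * yi) * (Kj + P * yj) = Ki * Kj + P * P * (yi * yj) + P * Kj * yi + P * Ki * yj := by ring
  have e1 : ∀ θ : ℝ, θ ≠ 0 → (Ki + P * (yi * θ)) * (Kj + P * (yj / θ)) =
      Ki * Kj + P * P * (yi * yj) + P * Kj * yi * θ + P * Ki * yj / θ := fun θ hθ => by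
    field_simp
    ring
  rw [e0, e1 tlo hlo.ne', e1 thi hthi.ne']
  exact key

end LeafLeafZ

end SafeCalc

end Summit.CriticalPhenomena.PercolationContinuityZ3.Theorems.SunflowerPartition
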